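import Literature.NumberTheory.PAdicHodge.AinfRamifiedComplete
import Mathlib.RingTheory.Jacobson.Ideal
import HarnessLib

/-!
# `A_inf(𝒪) = 𝔸_inf(F)[ϖ]` modulo the uniformizer: `A_inf(𝒪)/ϖ ≅ 𝒪_{ℂ_F}♭`, `p = ϖ^e · unit`, `⋂ₖ ϖ^k A_inf(𝒪) = 0`,
# and the `ϖ`-adic descent lemma

Topic `Literature/NumberTheory/PAdicHodge`; sequel of `AinfRamifiedComplete`. For an Eisenstein root datum `D = (f, ϖ)` over
the `p`-adic field `F` (`e = deg f`), the uniformizer `ϖ ∈ A_inf(𝒪)` plays the role that `p` plays in `𝔸_inf(F)`: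

* §1 **reduction modulo `ϖ`**: `A_inf(𝒪)/ϖ = 𝔸_inf(F)/p = 𝒪_{ℂ_F}♭` — the ring homomorphism
  `AinfRam.modVarpi : A_inf(𝒪) → 𝒪_{ℂ_F}♭` (`x ↦ x mod p` on `𝔸_inf(F) = 𝕎(𝒪_{ℂ_F}♭)`, `ϖ ↦ 0`), surjective with kernel
  `ϖ A_inf(𝒪)` (`ker_modVarpi_eq_span_varpi`; `ϖ ∣ p`); since `𝒪_{ℂ_F}♭` is a domain, **`ϖ ∣ xⁿ ⟹ ϖ ∣ x`**
  (`varpi_dvd_of_varpi_dvd_pow`).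
* §2 **`p = ϖ^e · v` with `v` a unit of `A_inf(𝒪)`** (`exists_unit_natCast_eq_varpi_pow_mul`): `ϖ^e = -p(u + ϖz)`
  (`exists_varpi_pow_eq_neg_natCast_mul`), `c₀ = p·u`, and `u + ϖz` is a unit because `ϖ` lies in the Jacobson radical of the `(p, ξ)`-adically complete ring
  `A_inf(𝒪)` (`varpi_mem_jacobson`).
* §3 **`⋂ₖ ϖ^k A_inf(𝒪) = 0`** (`eq_zero_of_forall_varpi_pow_dvd`; `ϖ^{ek} ∈ (p, ξ)^k`), `ϖ ≠ 0`.
* §4 **the `ϖ`-adic descent lemma** (`eq_zero_of_natCast_mul_eq_pow_mul`): if `p·T·R = T^N·S` with `R`, `S` units and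
  `N ≥ e + 2`, then `T = 0`. This is the ramified replacement of the reducedness argument `T^{p²} ∈ p𝔸_inf ⇒ T ∈ p𝔸_inf`
  of the unramified case (tree `AinfWeierstrassOmegaPeriodNonvanishing` (L2)): for a `p`-torsion point `T ∈ Ŵ(𝔫_𝒪)` of a
  supersingular formal group, `0 = [p]T = pT·R(T) + T^{p²}S(T)`, so `T = 0` — Fontaine's element of a Tate-module point
  with `[τ] = 0` vanishes, the input of the non-vanishing of the `ω`-period over a ramified base.

Definitions (reviewed): `AinfRam.modVarpi`. Theorems only otherwise; no named facts, no `sorry`, no instances.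
Infrastructure for hDR over a ramified base; nothing about elliptic curves is proved here.

## References
* [FarguesFontaine2018] L. Fargues, J.-M. Fontaine, Astérisque 406 (2018), §1.2 (`W_{𝒪_E}(A)/π = A`), §2.2.
* [FontaineAsterisque223III] J.-M. Fontaine, Astérisque 223 (1994), Exp. II §1.2–§1.3.
* [SerreLocalFields1979] J.-P. Serre, *Local Fields*, Ch. I §6 (Eisenstein polynomials: `v(ϖ^e) = v(p)`).
-/

noncomputable section

open ValuativeRel Field Ideal WittVector Polynomial

namespace Literature.NumberTheory.PAdicHodge

open Literature.NumberTheory.GaloisRepresentations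
open Literature.NumberTheory.GaloisRepresentations.IsNonarchimedeanLocalField

variable {F : Type} [Field F] [ValuativeRel F] [TopologicalSpace F] [IsNonarchimedeanLocalField F]
  [CharZero F] {p : ℕ} [Fact p.Prime] [Fact (¬ IsUnit (p : integerC F))]

namespace AinfRam

variable {hp : valuation F p < 1} (D : EisensteinRoot F p hp)

/-! ## §1 Reduction modulo `ϖ`: `A_inf(𝒪)/ϖ ≅ 𝒪_{ℂ_F}♭` -/

/-- `f ≡ X^e (mod p)`: the constant coefficient of `f ⊗ 𝔸_inf` reduces to `0` in `𝒪_{ℂ_F}♭ = 𝔸_inf(F)/p`.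
[cite: SerreLocalFields1979, Ch. I §6 Prop. 17] -/
theorem constantCoeff_eval₂_polyAinf_zero :
    D.polyAinf.eval₂ (WittVector.constantCoeff : Ainf (p := p) F →+* PreTilt (integerC F) p) 0 = 0 := by
  rw [EisensteinRoot.eval₂_polyAinf, Polynomial.eval₂_at_zero, RingHom.comp_apply]
  obtain ⟨d, hd⟩ := D.dvd_coeff D.e_pos
  rw [hd, map_mul, map_natCast, map_mul, map_natCast, CharP.cast_eq_zero, zero_mul]

/-- **Reduction modulo `ϖ`: `A_inf(𝒪) → 𝒪_{ℂ_F}♭`**, `a ↦ a mod p` on `𝔸_inf(F) = 𝕎(𝒪_{ℂ_F}♭)` and `ϖ ↦ 0`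
(Fargues–Fontaine: `W_{𝒪_E}(A)/π = A`). [cite: FarguesFontaine2018, §1.2] -/
def modVarpi : AinfRam D →+* PreTilt (integerC F) p :=
  AdjoinRoot.lift (WittVector.constantCoeff : Ainf (p := p) F →+* PreTilt (integerC F) p) 0
    (constantCoeff_eval₂_polyAinf_zero D)

/-- `modVarpi` on `𝔸_inf(F)` is reduction modulo `p`. [cite: FarguesFontaine2018, §1.2] -/
@[simp] theorem modVarpi_algebraMap (a : Ainf (p := p) F) :
    modVarpi D (algebraMap (Ainf (p := p) F) (AinfRam D) a) = WittVector.constantCoeff a := AdjoinRoot.lift_of _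

/-- `modVarpi ϖ = 0`. [cite: FarguesFontaine2018, §1.2] -/
@[simp] theorem modVarpi_varpi : modVarpi D (varpi D) = 0 := AdjoinRoot.lift_root _

/-- `modVarpi` is surjective (Teichmüller lifts). [cite: FarguesFontaine2018, §1.2] -/
theorem modVarpi_surjective : Function.Surjective (modVarpi D) := fun y =>
  ⟨algebraMap (Ainf (p := p) F) (AinfRam D) (teichmuller p y), by
    rw [modVarpi_algebraMap, WittVector.constantCoeff_apply, teichmuller_coeff_zero]⟩

/-- **`ϖ ∣ p` in `A_inf(𝒪)`**: `p·u = c₀ = -ϖ(ϖ^{e-1} + c_{e-1}ϖ^{e-2} + ⋯ + c₁)`. [cite: SerreLocalFields1979, Ch. I §6 Prop. 17] -/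
theorem varpi_dvd_natCast : varpi D ∣ (p : AinfRam D) := by
  -- `f(ϖ) = 0`: `c₀ = -(Σ_{1 ≤ i ≤ e} cᵢ ϖ^i)`, each term divisible by `ϖ`
  have h := eval₂_varpi' D
  rw [Polynomial.eval₂_eq_sum_range, Finset.sum_range_succ', pow_zero, mul_one] at h
  obtain ⟨u, hu⟩ := D.exists_coeff_zero_eq_mul_unit
  have h1 : ((algebraMap (Ainf (p := p) F) (AinfRam D)).comp zpToAinf) (D.poly.coeff 0) =
      (p : AinfRam D) * ((algebraMap (Ainf (p := p) F) (AinfRam D)).comp zpToAinf) (u : ℤ_[p]) := by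
    rw [hu, map_mul, map_natCast]
  have hunit : IsUnit (((algebraMap (Ainf (p := p) F) (AinfRam D)).comp zpToAinf) (u : ℤ_[p])) := u.isUnit.map _
  have h2 : (p : AinfRam D) * ((algebraMap (Ainf (p := p) F) (AinfRam D)).comp zpToAinf) (u : ℤ_[p]) =
      -∑ i ∈ Finset.range D.poly.natDegree,
        ((algebraMap (Ainf (p := p) F) (AinfRam D)).comp zpToAinf) (D.poly.coeff (i + 1)) * varpi D ^ (i + 1) := by
    rw [← h1]; exact eq_neg_of_add_eq_zero_right h
  have h3 : varpi D ∣ (p : AinfRam D) * ((algebraMap (Ainf (p := p) F) (AinfRam D)).comp zpToAinf) (u : ℤ_[p]) := by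
    rw [h2]
    refine (dvd_neg).2 (Finset.dvd_sum fun i _ => ?_)
    rw [pow_succ']
    exact Dvd.dvd.mul_left (dvd_mul_right _ _) _
  exact (hunit.dvd_mul_right).1 h3

/-- **`ker (A_inf(𝒪) → 𝒪_{ℂ_F}♭) = ϖ A_inf(𝒪)`**: `A_inf(𝒪)/ϖ ≅ 𝔸_inf(F)/p = 𝒪_{ℂ_F}♭`. [cite: FarguesFontaine2018, §1.2] -/
theorem ker_modVarpi_eq_span_varpi : RingHom.ker (modVarpi D) = Ideal.span {varpi D} := by
  refine le_antisymm (fun x hx => ?_) ((Ideal.span_singleton_le_iff_mem _).2 (modVarpi_varpi D))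
  rw [RingHom.mem_ker] at hx
  obtain ⟨q, rfl⟩ := AdjoinRoot.mk_surjective x
  -- `q = q(0) + X * q'`
  obtain ⟨q', hq'⟩ := Polynomial.X_dvd_iff.2 (show (q - C (q.coeff 0)).coeff 0 = 0 by simp)
  have hx' : AdjoinRoot.mk D.polyAinf q =
      algebraMap (Ainf (p := p) F) (AinfRam D) (q.coeff 0) + varpi D * AdjoinRoot.mk D.polyAinf q' := by
    have : q = C (q.coeff 0) + X * q' := by rw [← hq']; ring
    conv_lhs => rw [this]
    rw [map_add, map_mul, AdjoinRoot.mk_C, AdjoinRoot.mk_X, algebraMap_eq, varpi]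
  rw [hx', map_add, map_mul, modVarpi_varpi, zero_mul, add_zero, modVarpi_algebraMap,
    WittVector.constantCoeff_apply, ← WittVector.mem_span_p_iff_coeff_zero_eq_zero, Ideal.mem_span_singleton] at hx
  rw [hx']
  refine Ideal.add_mem _ ?_ (Ideal.mul_mem_right _ _ (Ideal.mem_span_singleton_self _))
  rw [Ideal.mem_span_singleton]
  exact (varpi_dvd_natCast D).trans ((map_natCast (algebraMap (Ainf (p := p) F) (AinfRam D)) p) ▸ map_dvd _ hx)

/-- `modVarpi x = 0 ↔ ϖ ∣ x`. [cite: FarguesFontaine2018, §1.2] -/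
theorem modVarpi_eq_zero_iff (x : AinfRam D) : modVarpi D x = 0 ↔ varpi D ∣ x := by
  rw [← RingHom.mem_ker, ker_modVarpi_eq_span_varpi, Ideal.mem_span_singleton]

/-- **`ϖ ∣ xⁿ ⟹ ϖ ∣ x`** (`A_inf(𝒪)/ϖ = 𝒪_{ℂ_F}♭` is a domain). [cite: FarguesFontaine2018, §1.2] -/
theorem varpi_dvd_of_varpi_dvd_pow {x : AinfRam D} {n : ℕ} (h : varpi D ∣ x ^ n) : varpi D ∣ x := by
  rw [← modVarpi_eq_zero_iff] at h ⊢
  rw [map_pow] at h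
  exact pow_eq_zero_iff'.1 h |>.1

/-! ## §2 `ϖ` lies in the Jacobson radical; `p = ϖ^e · unit` -/

variable [IsAdicComplete (Ideal.span {(p : integerC F)}) (integerC F)]

/-- `J = (p, ξ) A_inf(𝒪)` lies in the Jacobson radical (`A_inf(𝒪)` is `J`-adically complete).
[cite: FontaineAsterisque223III, Exp. II §1.3.2] -/
theorem idealPXi_le_jacobson : idealPXi D ≤ (⊥ : Ideal (AinfRam D)).jacobson := by
  haveI := isAdicComplete_idealPXi D
  exact IsAdicComplete.le_jacobson_bot _

/-- **`ϖ` lies in the Jacobson radical of `A_inf(𝒪)`** (`ϖ^e ∈ (p) ⊆ J`, and the Jacobson radical is radical).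
[cite: FontaineAsterisque223III, Exp. II §1.3.2] -/
theorem varpi_mem_jacobson : varpi D ∈ (⊥ : Ideal (AinfRam D)).jacobson :=
  (Ideal.isRadical_jacobson ⊥) ⟨D.e, idealPXi_le_jacobson D (varpi_pow_mem_idealPXi D)⟩

/-- `u + ϖ·z` is a unit for a unit `u`. [cite: FontaineAsterisque223III, Exp. II §1.3.2] -/
theorem isUnit_add_varpi_mul {u : AinfRam D} (hu : IsUnit u) (z : AinfRam D) : IsUnit (u + varpi D * z) := by
  obtain ⟨v, rfl⟩ := hu
  have h := Ideal.mem_jacobson_bot.1 (varpi_mem_jacobson D) (z * (v⁻¹ : (AinfRam D)ˣ))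
  have h1 : (v : AinfRam D) * (v⁻¹ : (AinfRam D)ˣ) = 1 := Units.mul_inv v
  have : (v : AinfRam D) + varpi D * z = v * (varpi D * (z * (v⁻¹ : (AinfRam D)ˣ)) + 1) := by
    linear_combination (-(varpi D * z)) * h1
  rw [this]
  exact (Units.isUnit v).mul h

omit [IsAdicComplete (Ideal.span {(p : integerC F)}) (integerC F)] in
/-- **`ϖ^e = -p · y` with `y = u + ϖ·z`, `u ∈ ℤ_pˣ`** (Eisenstein: `cᵢ = p dᵢ`, `c₀ = p u`).
[cite: SerreLocalFields1979, Ch. I §6 Prop. 17] -/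
theorem exists_varpi_pow_eq_neg_natCast_mul :
    ∃ (u : ℤ_[p]ˣ) (z : AinfRam D), varpi D ^ D.e =
      -((p : AinfRam D) * (algebraMap (Ainf (p := p) F) (AinfRam D) (zpToAinf (u : ℤ_[p])) + varpi D * z)) := by
  -- coefficients `cᵢ = p dᵢ`
  obtain ⟨d, hd⟩ : ∃ d : ℕ → ℤ_[p], ∀ i, i < D.e → D.poly.coeff i = (p : ℤ_[p]) * d i :=
    ⟨fun i => if hi : i < D.e then (D.dvd_coeff hi).choose else 0, fun i hi => by
      simp only [dif_pos hi]; exact (D.dvd_coeff hi).choose_spec⟩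
  obtain ⟨u, hu⟩ := D.exists_coeff_zero_eq_mul_unit
  have hd0 : d 0 = (u : ℤ_[p]) := by
    have h0 := hd 0 D.e_pos
    rw [hu] at h0
    exact (mul_left_cancel₀ (Nat.cast_ne_zero.2 (Fact.out : p.Prime).ne_zero) h0).symm
  -- `f(ϖ) = 0`
  have h := eval₂_varpi' D
  rw [Polynomial.eval₂_eq_sum_range, Finset.sum_range_succ, ← D.e_def, show D.poly.coeff D.e = 1 from D.monic,
    map_one, one_mul] at h
  obtain ⟨m, hm⟩ := Nat.exists_eq_add_of_le' D.e_pos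
  refine ⟨u, ∑ i ∈ Finset.range m, algebraMap (Ainf (p := p) F) (AinfRam D) (zpToAinf (d (i + 1))) * varpi D ^ i, ?_⟩
  rw [eq_neg_of_add_eq_zero_right h, hm, Finset.sum_range_succ', pow_zero, mul_one, RingHom.comp_apply, hd 0 D.e_pos, hd0,
    map_mul, map_mul, map_natCast, map_natCast, neg_inj, mul_add, Finset.mul_sum]
  conv_lhs => rw [add_comm]
  rw [add_right_inj, Finset.mul_sum]
  apply Finset.sum_congr rfl
  intro i hi
  rw [RingHom.comp_apply, hd (i + 1) (by rw [hm]; exact Nat.succ_lt_succ (Finset.mem_range.1 hi)), map_mul, map_mul,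
    map_natCast, map_natCast, pow_succ]
  ring

/-- **`p = ϖ^e · v` for a unit `v` of `A_inf(𝒪)`** (`ϖ^e = -p(u + ϖz)` and `u + ϖz` is a unit, §2).
[cite: SerreLocalFields1979, Ch. I §6 Prop. 17] -/
theorem exists_unit_natCast_eq_varpi_pow_mul : ∃ v : (AinfRam D)ˣ, (p : AinfRam D) = varpi D ^ D.e * v := by
  obtain ⟨u, z, h⟩ := exists_varpi_pow_eq_neg_natCast_mul D
  obtain ⟨w, hw⟩ := isUnit_add_varpi_mul D ((u.isUnit.map zpToAinf).map (algebraMap (Ainf (p := p) F) (AinfRam D))) z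
  refine ⟨-w⁻¹, ?_⟩
  rw [Units.val_neg, mul_neg, h, ← hw, neg_mul, neg_neg, mul_assoc, Units.mul_inv, mul_one]

/-! ## §3 `⋂ₖ ϖ^k A_inf(𝒪) = 0` -/

/-- **`⋂ₖ ϖ^k A_inf(𝒪) = 0`** (`ϖ^{ek} ∈ (p) ^ k ⊆ J^k` and `A_inf(𝒪)` is `J`-adically separated).
[cite: FontaineAsterisque223III, Exp. II §1.3.2] -/
theorem eq_zero_of_forall_varpi_pow_dvd {x : AinfRam D} (h : ∀ k : ℕ, varpi D ^ k ∣ x) : x = 0 :=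
  eq_zero_of_forall_mem_idealPXi_pow D fun n => by
    obtain ⟨c, hc⟩ := h (D.e * n)
    rw [hc, pow_mul]
    exact Ideal.mul_mem_right _ _ (Ideal.pow_mem_pow (varpi_pow_mem_idealPXi D) n)

/-- `ϖ ≠ 0` in `A_inf(𝒪)` (`θ_𝒪(ϖ) = ϖ ≠ 0`). [cite: FarguesFontaine2018, §2.2] -/
theorem varpi_ne_zero : varpi D ≠ 0 := fun h => by
  have h1 := D.norm_rootC_pow
  rw [← theta_varpi, h, map_zero, ZeroMemClass.coe_zero, norm_zero, zero_pow D.e_pos.ne'] at h1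
  exact (norm_pos_iff.2 (natCast_C_ne_zero (F := F) (Fact.out : p.Prime).ne_zero)).ne' h1.symm

/-! ## §4 The `ϖ`-adic descent lemma -/

/-- **`ϖ`-adic descent**: if `p·T·R = T^N·S` in `A_inf(𝒪)` with `R`, `S` units and `N ≥ e + 2`, then `ϖ^k ∣ T` for every
`k` — peel off one `ϖ` at a time: `T^N S ∈ ϖA ⇒ T ∈ ϖA` (§1), then with `p = ϖ^e v` and `T = ϖ^k T'`,
`v T' R = ϖ^{kN-k-e} T'^N S ∈ ϖA`. [cite: FarguesFontaine2018, §2.2] -/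
theorem varpi_pow_dvd_of_natCast_mul_eq_pow_mul (hF : Function.Surjective (fontaineTheta (integerC F) p))
    {T R S : AinfRam D} (hR : IsUnit R) (hS : IsUnit S) {N : ℕ} (hN : D.e + 2 ≤ N)
    (h : (p : AinfRam D) * T * R = T ^ N * S) : ∀ k : ℕ, varpi D ^ k ∣ T := by
  haveI := isDomain D hF
  obtain ⟨v, hv⟩ := exists_unit_natCast_eq_varpi_pow_mul D
  intro k
  induction k with
  | zero => rw [pow_zero]; exact one_dvd _
  | succ k ih =>
    obtain ⟨T', rfl⟩ := ih
    rcases Nat.eq_zero_or_pos k with rfl | hk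
    · -- `T^N S = p T R ∈ ϖ A`, `S` unit, so `ϖ ∣ T^N`, so `ϖ ∣ T`
      rw [pow_zero, one_mul] at *
      rw [zero_add, pow_one]
      refine varpi_dvd_of_varpi_dvd_pow D (n := N) ((hS.dvd_mul_right).1 ?_)
      rw [← h, mul_assoc]
      exact (varpi_dvd_natCast D).mul_right _
    · -- `ϖ^e v ϖ^k T' R = ϖ^{kN} T'^N S`; cancel `ϖ^{k+e}`: `v T' R = ϖ^{kN - k - e} T'^N S`
      have hle : k + D.e + 1 ≤ k * N := by nlinarith
      obtain ⟨m, hm⟩ := Nat.exists_eq_add_of_le hle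
      have h1 : varpi D ^ (k + D.e) * ((v : AinfRam D) * T' * R) =
          varpi D ^ (k + D.e) * (varpi D ^ (m + 1) * T' ^ N * S) := by
        have h2 : (p : AinfRam D) * (varpi D ^ k * T') * R = (varpi D ^ k * T') ^ N * S := h
        rw [hv, mul_pow, ← pow_mul, hm] at h2
        calc varpi D ^ (k + D.e) * ((v : AinfRam D) * T' * R)
            = varpi D ^ D.e * v * (varpi D ^ k * T') * R := by ring
          _ = varpi D ^ (k + D.e + 1 + m) * T' ^ N * S := h2
          _ = varpi D ^ (k + D.e) * (varpi D ^ (m + 1) * T' ^ N * S) := by ring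
      have h3 : (v : AinfRam D) * T' * R = varpi D ^ (m + 1) * T' ^ N * S :=
        mul_left_cancel₀ (pow_ne_zero _ (varpi_ne_zero D)) h1
      have h4 : varpi D ∣ (v : AinfRam D) * T' * R := by
        rw [h3, pow_succ, mul_assoc, mul_assoc]
        exact Dvd.dvd.mul_left (dvd_mul_right _ _) _
      have h5 : varpi D ∣ T' := by
        rw [mul_assoc] at h4
        exact (hR.dvd_mul_right).1 ((v.isUnit.dvd_mul_left).1 h4)
      obtain ⟨T'', rfl⟩ := h5
      exact ⟨T'', by ring⟩

/-- **The `ϖ`-adic descent lemma**: `p·T·R = T^N·S` with `R`, `S` units and `N ≥ e + 2` forces `T = 0`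
(`⋂ₖ ϖ^k A_inf(𝒪) = 0`). Applied to `0 = [p]T = pT·R(T) + T^{p²}·S(T)` for a supersingular formal group over `𝒪_D`
with `p ≥ 5` (`e ≤ p² - 2`), it shows that a `p`-torsion point of `Ŵ(𝔫_𝒪)` vanishes. [cite: FarguesFontaine2018, §2.2] -/
theorem eq_zero_of_natCast_mul_eq_pow_mul (hF : Function.Surjective (fontaineTheta (integerC F) p))
    {T R S : AinfRam D} (hR : IsUnit R) (hS : IsUnit S) {N : ℕ} (hN : D.e + 2 ≤ N)
    (h : (p : AinfRam D) * T * R = T ^ N * S) : T = 0 :=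
  eq_zero_of_forall_varpi_pow_dvd D (varpi_pow_dvd_of_natCast_mul_eq_pow_mul D hF hR hS hN h)

end AinfRam

end Literature.NumberTheory.PAdicHodge

end
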